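import Summits.RiemannHypothesis.RiemannHypothesis.Theses.RuelleBand
import Literature.Barriers.RiemannHypothesis.BeurlingCounterexamples
import Literature.Barriers.RiemannHypothesis.DavenportHeilbronnSaiasWeingartnerHolds

/-!
# `AsymptoticCriticalLine` (crux `stmt-RiemannHypothesis-2063`, route `RuelleBand`):
# the band SHAPE fails for `ζ`-like objects (negative-side support: refuted strengthenings)

Support file of the crux disprover (cdisprove seat refuter-cdisprove-stmt-RiemannHypothesis-2063-0),
companion of `BandForms.lean`. The crux says that every *band*
`shapeBand Z ε = {s | Z s = 0 ∧ 0 < Re s ∧ Re s < 1 ∧ ε ≤ |Re s − 1/2|}` (`ε > 0`) of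
`Z = riemannZeta` is finite. Each theorem below exhibits an infinite band for a function sharing
much of the structure of `ζ`, so a proof of the crux must use an input the object lacks:

* `not_band_zetaTwistedAtTwo` (unconditional): `(1 − 2^{3/4−s}) ζ(s)` — multiplicative
  coefficients, Euler product over all primes, ONE non-tempered local factor — contains the whole
  line `{3/4 + 2πik/log 2}` in its level-`1/4` band: temperedness of EVERY local factor is used
  (the Selberg-class axiom `θ < 1/2`);
* `not_band_swF` (unconditional, from the tree's PROVED Saias–Weingartner 2009 Thm 2,
  `Literature.Barriers.RiemannHypothesis.SaiasWeingartner_holds`): `L(s,χ₃) + L(s,χ₅)` (quadratic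
  characters mod `3`, `5`) has `≥ cT` zeros with `3/4 < Re s < 1`, `|Im s| ≤ T`: the band property is
  not additive, nor a property of Dirichlet series with periodic coefficients + continuation +
  finite order + mean values (barrier `DavenportHeilbronnNarrow`): the Euler product of `ζ` itself
  must enter;
* `exists_beurling_not_band` (modulo the catalogued named fact
  `DiamondMontgomeryVorhauer2006_thm1`): Beurling integers with `N(x) = κx + O(x^{3/4})` whose zeta
  function has infinitely many zeros on `σ = 1 − 2/log t` (real parts accumulating at `1`):
  Landau–Beurling methods (barrier `BeurlingCounterexamples`) cannot prove the crux.
-/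

noncomputable section

namespace Summit.RiemannHypothesis.RiemannHypothesis.Theorems.AsymptoticCriticalLine.Negative

open Complex Set

/-- The *band* of a function `Z` at level `ε` (the crux's set-builder with `Z` for `ζ`): zeros of
`Z` in the open critical strip at distance `≥ ε` from the critical line. [folklore] -/
def shapeBand (Z : ℂ → ℂ) (ε : ℝ) : Set ℂ :=
  {s : ℂ | Z s = 0 ∧ 0 < s.re ∧ s.re < 1 ∧ ε ≤ |s.re - 1 / 2|}

/-- The crux is the finiteness of every positive-level band of `riemannZeta`. [folklore] -/
theorem acl_iff_shapeBand :
    Summit.RiemannHypothesis.RiemannHypothesis.Theses.RuelleBand.AsymptoticCriticalLine ↔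
      ∀ ε : ℝ, 0 < ε → (shapeBand riemannZeta ε).Finite := Iff.rfl

/-! ## 1. The SHAPE fails for `ζ`-like objects (refuted strengthenings / barrier reductions)

Each theorem exhibits a "second band" for a function sharing much of the structure of `ζ`; a
proof of the crux must use an input that the corresponding object lacks. -/

/-! ### 1a. One non-tempered local factor creates a whole second band (unconditional) -/

/-- `ζ` with its Euler factor at `p = 2` multiplied by `1 − 2^{3/4−s}`:
`Z₂(s) = (1 − 2^{3/4}·2^{−s}) ζ(s) = ∑ a(n) n^{−s}` with the MULTIPLICATIVE coefficients
`a(n) = 1` (`n` odd), `a(n) = 1 − 2^{3/4}` (`n` even); Euler product over all primes, degree one at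
every odd prime, continuation and growth of `ζ`, same zeros as `ζ` PLUS the vertical line
`Re s = 3/4` coming from the single modified factor (whose logarithmic coefficients
`b(2^k) = −2^{3k/4}/k` violate exactly the Selberg-class axiom `b(p^k) ≪ p^{kθ}`, `θ < 1/2`).
[folklore] -/
def zetaTwistedAtTwo (s : ℂ) : ℂ :=
  (1 - (2 : ℂ) ^ ((3 : ℂ) / 4 - s)) * riemannZeta s

/-- The points `3/4 + 2πik/log 2` of the second band of `zetaTwistedAtTwo`. [folklore] -/
def secondBandPt (k : ℕ) : ℂ :=
  (((3 : ℝ) / 4 : ℝ) : ℂ) + ((2 * Real.pi / Real.log 2 * k : ℝ) : ℂ) * I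

/-- [folklore] -/
theorem secondBandPt_re (k : ℕ) : (secondBandPt k).re = 3 / 4 := by
  simp only [secondBandPt, add_re, ofReal_re, mul_re, I_re, I_im, ofReal_im, mul_zero, mul_one,
    sub_zero, add_zero]

/-- [folklore] -/
theorem secondBandPt_im (k : ℕ) : (secondBandPt k).im = 2 * Real.pi / Real.log 2 * k := by
  simp only [secondBandPt, add_im, ofReal_im, mul_im, ofReal_re, I_re, I_im, mul_zero, mul_one,
    zero_add, add_zero]

/-- `2^{3/4 − s_k} = exp(−2πik) = 1`. [folklore] -/
theorem two_cpow_secondBandPt (k : ℕ) : (2 : ℂ) ^ ((3 : ℂ) / 4 - secondBandPt k) = 1 := by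
  have hlog : Complex.log 2 = (Real.log 2 : ℂ) := by
    rw [show (2 : ℂ) = ((2 : ℝ) : ℂ) by norm_num, ← Complex.ofReal_log (by norm_num)]
  have hlog0 : (Real.log 2 : ℂ) ≠ 0 := by exact_mod_cast (Real.log_pos one_lt_two).ne'
  rw [Complex.cpow_def_of_ne_zero two_ne_zero, hlog, Complex.exp_eq_one_iff]
  refine ⟨-(k : ℤ), ?_⟩
  simp only [secondBandPt]
  push_cast
  field_simp
  ring

/-- Every `s_k` is a zero of `zetaTwistedAtTwo`. [folklore] -/
theorem zetaTwistedAtTwo_secondBandPt (k : ℕ) : zetaTwistedAtTwo (secondBandPt k) = 0 := by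
  rw [zetaTwistedAtTwo, two_cpow_secondBandPt, sub_self, zero_mul]

/-- [folklore] -/
theorem secondBandPt_injective : Function.Injective secondBandPt := by
  intro a b hab
  have h' := congrArg Complex.im hab
  rw [secondBandPt_im, secondBandPt_im] at h'
  have hc : (2 * Real.pi / Real.log 2 : ℝ) ≠ 0 :=
    div_ne_zero (by positivity) (Real.log_pos one_lt_two).ne'
  exact_mod_cast mul_left_cancel₀ hc h'

/-- REFUTED STRENGTHENING (unconditional): the band shape fails for `ζ` with one local factor made
non-tempered — the level-`1/4` band of `zetaTwistedAtTwo` contains the infinite line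
`{3/4 + 2πik/log 2}`. Any proof of the crux must use the exact (tempered) shape of EVERY Euler
factor. [folklore] -/
theorem not_band_zetaTwistedAtTwo : ¬ ∀ ε : ℝ, 0 < ε → (shapeBand zetaTwistedAtTwo ε).Finite := by
  intro h
  have hfin := h (1 / 4) (by norm_num)
  have hsub : Set.range secondBandPt ⊆ shapeBand zetaTwistedAtTwo (1 / 4) := by
    rintro _ ⟨k, rfl⟩
    refine ⟨zetaTwistedAtTwo_secondBandPt k, ?_, ?_, ?_⟩ <;> rw [secondBandPt_re] <;>
      norm_num [abs_of_pos]
  exact (Set.infinite_range_of_injective secondBandPt_injective).mono hsub hfin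

/-! ### 1b. Linear combinations of `L`-functions: `≫ T` zeros in every strip (unconditional) -/

/-- `Fact (Nat.Prime 5)` (Mathlib registers `2` and `3` only). [folklore] -/
instance fact_prime_five : Fact (Nat.Prime 5) := ⟨by norm_num⟩

/-- The quadratic (Legendre) character mod a prime `p`, as a complex Dirichlet character.
[folklore] -/
def quadChar (p : ℕ) [Fact p.Prime] : DirichletCharacter ℂ p :=
  (quadraticChar (ZMod p)).ringHomComp (Int.castRingHom ℂ)

/-- For odd `p` the quadratic character is non-trivial … [folklore] -/
theorem quadChar_ne_one (p : ℕ) [Fact p.Prime] (hp2 : p ≠ 2) : quadChar p ≠ 1 :=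
  (MulChar.ringHomComp_ne_one_iff (f := Int.castRingHom ℂ) Int.cast_injective).2
    (quadraticChar_ne_one (by rw [ZMod.ringChar_zmod_n]; exact hp2))

/-- … hence primitive (a non-trivial character of prime level has conductor `p`). [folklore] -/
theorem quadChar_isPrimitive (p : ℕ) [hp : Fact p.Prime] (hp2 : p ≠ 2) :
    (quadChar p).IsPrimitive := by
  rw [DirichletCharacter.isPrimitive_def]
  rcases (Nat.dvd_prime hp.out).mp (quadChar p).conductor_dvd_level with h1 | h1
  · exact absurd ((DirichletCharacter.eq_one_iff_conductor_eq_one (χ := quadChar p)).mpr h1)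
      (quadChar_ne_one p hp2)
  · exact h1

/-- Levels of the Saias–Weingartner family `{χ₃, χ₅}`. [folklore] -/
def swLevel : Bool → ℕ := fun b => cond b 5 3

/-- The levels `3`, `5` are non-zero. [folklore] -/
instance swLevel_neZero (b : Bool) : NeZero (swLevel b) := ⟨by cases b <;> decide⟩

/-- The family `{χ₃, χ₅}` of quadratic characters mod `3` and mod `5`. [folklore] -/
def swChar : ∀ b : Bool, DirichletCharacter ℂ (swLevel b)
  | false => quadChar 3
  | true => quadChar 5

/-- [folklore] -/
theorem swChar_isPrimitive : ∀ b : Bool, (swChar b).IsPrimitive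
  | false => quadChar_isPrimitive 3 (by decide)
  | true => quadChar_isPrimitive 5 (by decide)

/-- [folklore] -/
theorem swSigma_injective :
    Function.Injective (fun b ↦ (⟨swLevel b, swChar b⟩ : Σ n, DirichletCharacter ℂ n)) := by
  intro a b hab
  have h1 := congrArg Sigma.fst hab
  cases a <;> cases b <;> first | rfl | (simp [swLevel] at h1)

/-- [folklore] -/
theorem support_delta_finite : (Function.support LSeries.delta).Finite := by
  refine (Set.finite_singleton 1).subset fun n hn => ?_
  rw [Set.mem_singleton_iff]
  by_contra h
  exact hn (by rw [LSeries.delta, if_neg h])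

/-- `F(s) = L(s, χ₃) + L(s, χ₅)`: an entire Dirichlet series with `15`-periodic coefficients, sum
of two degree-one Euler products each of which is expected (GRH) to have all its non-trivial zeros
on `Re s = 1/2`. [folklore] -/
def swF (s : ℂ) : ℂ :=
  (swChar false).LFunction s + (swChar true).LFunction s

/-- `swF = L(·, χ₃) + L(·, χ₅)` on the nose. [folklore] -/
theorem swF_eq (s : ℂ) : swF s = (quadChar 3).LFunction s + (quadChar 5).LFunction s := rfl

/-- REFUTED STRENGTHENING (unconditional; Saias–Weingartner 2009 Thm 2, PROVED in tree as
`Literature.Barriers.RiemannHypothesis.SaiasWeingartner_holds`): the band shape fails for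
`F = L(·,χ₃) + L(·,χ₅)` — its level-`1/4` band (`3/4 < Re s < 1`) carries `≥ cT` zeros of height
`≤ T` for all large `T`. The band statement is NOT additive, nor a property of Dirichlet series
with periodic coefficients, continuation, finite order and mean values: the crux needs the Euler
product of `ζ` itself (barrier `Literature.Barriers.RiemannHypothesis.DavenportHeilbronnNarrow`).
[folklore] -/
theorem not_band_swF : ¬ ∀ ε : ℝ, 0 < ε → (shapeBand swF ε).Finite := by
  intro hband
  obtain ⟨η, hη, hstrip⟩ :=
    Literature.Barriers.RiemannHypothesis.SaiasWeingartner_holds Bool swLevel swChar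
      (fun _ => LSeries.delta) (by simp) swChar_isPrimitive swSigma_injective
      (fun _ => ⟨support_delta_finite, 1, one_ne_zero, by simp [LSeries.delta]⟩)
  obtain ⟨c, hc, T₀, hT⟩ := hstrip (3 / 4) 1 (by norm_num) (by norm_num) (by linarith)
  have hfin := hband (1 / 4) (by norm_num)
  set N : ℕ := hfin.toFinset.card with hN
  obtain ⟨Z, hZcard, hZ⟩ := hT (max T₀ (((N : ℝ) + 1) / c)) (le_max_left _ _)
  have hZsub : ∀ s ∈ Z, s ∈ shapeBand swF (1 / 4) := by
    intro s hs
    obtain ⟨h1, h2, _, h4⟩ := hZ s hs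
    simp only [Fintype.sum_bool, LSeries_delta, Pi.one_apply, one_mul] at h4
    refine ⟨?_, by linarith, h2, ?_⟩
    · unfold swF
      linear_combination h4
    · rw [abs_of_pos (by linarith)]
      linarith
  have hcard : Z.card ≤ N :=
    Finset.card_le_card fun s hs => (Set.Finite.mem_toFinset hfin).2 (hZsub s hs)
  have hge : (N : ℝ) + 1 ≤ c * max T₀ (((N : ℝ) + 1) / c) :=
    calc (N : ℝ) + 1 = c * (((N : ℝ) + 1) / c) := by field_simp
      _ ≤ c * max T₀ (((N : ℝ) + 1) / c) := by gcongr; exact le_max_right _ _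
  have h1 : (N : ℝ) + 1 ≤ Z.card := hge.trans hZcard
  have h2 : (Z.card : ℝ) ≤ N := by exact_mod_cast hcard
  linarith

/-! ### 1c. Beurling zeta functions: zeros ACCUMULATE at `Re s = 1` (modulo the catalogued DMV fact) -/

open Literature.Barriers.RiemannHypothesis in
/-- BARRIER REDUCTION (modulo the catalogued named fact
`Literature.Barriers.RiemannHypothesis.DiamondMontgomeryVorhauer2006_thm1`, DMV 2006 Thm 1 with
`θ = 3/4`, `a = 2`): there is a Beurling prime system with integer count `N(x) = κx + O(x^{3/4})`
whose zeta function, continued to `Re s > 3/4`, violates the band shape MAXIMALLY — infinitely many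
zeros on `σ = 1 − 2/log t`, so `Re ρ → 1` along them. No argument using of `ℤ` only
multiplicativity and `N(x) = κx + O(x^θ)` (`θ > 1/2`; barrier
`Literature.Barriers.RiemannHypothesis.BeurlingCounterexamples`) proves the crux. [folklore] -/
theorem exists_beurling_not_band (h : DiamondMontgomeryVorhauer2006_thm1) :
    ∃ (P : BeurlingPrimes) (κ : ℝ) (Z : ℂ → ℂ), 0 < κ ∧
      (∃ C : ℝ, ∀ x : ℝ, 1 ≤ x → |(P.intCount x : ℝ) - κ * x| ≤ C * x ^ (3 / 4 : ℝ)) ∧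
      (∀ s : ℂ, 1 < s.re → Z s = P.zeta s) ∧
      DifferentiableOn ℂ Z {s : ℂ | 3 / 4 < s.re ∧ s ≠ 1} ∧
      {s : ℂ | 2 ≤ s.im ∧ 3 / 4 < s.re ∧ s.re = 1 - 2 / Real.log s.im ∧ Z s = 0}.Infinite ∧
      ¬ ∀ ε : ℝ, 0 < ε → (shapeBand Z ε).Finite := by
  have he : 4 / Real.exp 1 * (1 - 3 / 4) < 2 := by
    have h1 : 1 < Real.exp 1 := Real.one_lt_exp_iff.mpr one_pos
    have h4 : 4 / Real.exp 1 < 4 := by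
      rw [div_lt_iff₀ (by positivity)]; nlinarith
    have h5 : 0 < 4 / Real.exp 1 := by positivity
    nlinarith
  obtain ⟨P, κ, hκ, hN, ⟨Z, hZ, hdiff, _, hinf, _⟩, _, _⟩ :=
    h (3 / 4) 2 (by norm_num) (by norm_num) he
  refine ⟨P, κ, Z, hκ, hN, hZ, hdiff, hinf, fun hband => ?_⟩
  refine hinf ((hband (1 / 4) (by norm_num)).subset ?_)
  rintro s ⟨him, hre, hcurve, hz⟩
  have hlog : 0 < Real.log s.im := Real.log_pos (by linarith)
  have hdiv : 0 < 2 / Real.log s.im := by positivity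
  refine ⟨hz, by linarith, by linarith, ?_⟩
  rw [abs_of_pos (by linarith)]
  linarith

end Summit.RiemannHypothesis.RiemannHypothesis.Theorems.AsymptoticCriticalLine.Negative
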